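import Summits.ValiantsHypothesis.ValiantsHypothesis.Theorems.SymPencilPerFourInnerRankPureGramNuRelabel
import Summits.ValiantsHypothesis.ValiantsHypothesis.Theorems.SymPencilPerFourInnerRankPureGramLinePPP

/-!
# Route `SymPencil` — inner rank of the `2 | 2` row split of `per_4`: **P1, a pure `per_4`-design
# needs at least twelve squares** (glue file)
# (`--supports` stmt-ValiantsHypothesis-5674 `SdcSuperquadratic`; (8,8) column of the size tables; rung currency only)

**Theorem** (`false_of_allX`).  Over a field of characteristic zero there is no identity
`Σ_r c_r t_r((a,b),(y₂,y₃))² = per (a; b; y₂; y₃)` with `|ι| ≤ 11` bilinear-by-bilinear squares that is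
PURE (`t_r((a,0),(e_k,0)) = t_r((0,b),(0,e_k)) = 0`): problem P1 of the memos
`NOTE-p6g15-5674-IR12-reduction.md` / `NOTE-p8g14-5674-P1-structure.md`.

Proof = composition of the two landed halves, nothing else:
* val-port-4's `…PureGramNuRelabel.false_of_allX_of_line_ppp` (STEP (2) — the 151-node `ν`-kernel tree
  `…PureGramNuTree*`, the side trichotomies `…PureGramNuSide`, the rescaling/translation assembly
  `…PureGramNuAssembly` and the `S₄`-relabelling of the classes `++-`, `+--` to `+++`), which leaves ONE
  hypothesis `Hppp`: «a pure design on `ι` whose `ν`-Gram table is literally the `+++` table is contradictory»;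
* this lineage's `…PureGramLinePPP.false_of_allX_of_nGram_c0_ppp` (STEPS (4)–(5) — kernel elimination on the
  line `ν-Gram = c₀` and the 36-step chain of `2 × 2` product-minor certificates `certchain_ppp.json`,
  files `…PureGramLinePPPKernel … Case12`), which IS `Hppp` pointwise.

Honest framing: P1 is ONE of the two inputs (with R2, the peeled case) of the CONDITIONAL closing of the
cells `(8,8,10)`, `(8,8,11)` via `…PureReduction.pure_reduction`; no cell closes here; the window
`27 ≤ sdc(per_4) ≤ 29`, the crux `SdcSuperquadratic` and `VP ≠ VNP` are untouched.  No definitions,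
no named facts. [folklore]
-/

noncomputable section

-- single-conjunct layout: Sub = Summit, duplicated namespace component intended
set_option linter.dupNamespace false

namespace Summit.ValiantsHypothesis.ValiantsHypothesis.Theorems.SymPencilPerFourInnerRankPureGramP1

open Summit.ValiantsHypothesis.ValiantsHypothesis.Theorems.SymPencilPerFourInnerRankPureGramNuRelabel
open Summit.ValiantsHypothesis.ValiantsHypothesis.Theorems.SymPencilPerFourInnerRankPureGramLinePPP

variable {K : Type*} [Field K] [CharZero K] {ι : Type*} [Fintype ι]

/-- **P1.**  A pure weighted sum-of-squares identity for `per_4` (bilinear-by-bilinear squares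
`t_r((a,b),(y₂,y₃))` with `t_r((a,0),(e_k,0)) = t_r((0,b),(0,e_k)) = 0`) over a field of characteristic
zero has at least twelve squares: `|ι| ≤ 11` is contradictory. [folklore] -/
theorem false_of_allX [DecidableEq ι] (hι : Fintype.card ι ≤ 11) (c : ι → K)
    (t : ι → (((Fin 4 → K) × (Fin 4 → K)) →ₗ[K] ((Fin 4 → K) × (Fin 4 → K)) →ₗ[K] K))
    (hJ : ∀ a b y₂ y₃ : Fin 4 → K,
      ∑ r, c r * (t r (a, b) (y₂, y₃)) ^ 2 = (Matrix.of ![a, b, y₂, y₃]).permanent)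
    (hX : ∀ k : Fin 4, (∀ (a : Fin 4 → K) r, t r (a, 0) (Pi.single k 1, 0) = 0) ∧
        (∀ (b : Fin 4 → K) r, t r (0, b) (0, Pi.single k 1) = 0)) : False :=
  false_of_allX_of_line_ppp hι c t hJ hX
    (fun c' t' hJ' hX' hN' => false_of_allX_of_nGram_c0_ppp hι c' t' hJ' hX' hN')

/-- **P1, cardinal form.**  Every pure `per_4`-design over a field of characteristic zero has at least
twelve squares. [folklore] -/
theorem twelve_le_card_of_allX [DecidableEq ι] (c : ι → K)
    (t : ι → (((Fin 4 → K) × (Fin 4 → K)) →ₗ[K] ((Fin 4 → K) × (Fin 4 → K)) →ₗ[K] K))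
    (hJ : ∀ a b y₂ y₃ : Fin 4 → K,
      ∑ r, c r * (t r (a, b) (y₂, y₃)) ^ 2 = (Matrix.of ![a, b, y₂, y₃]).permanent)
    (hX : ∀ k : Fin 4, (∀ (a : Fin 4 → K) r, t r (a, 0) (Pi.single k 1, 0) = 0) ∧
        (∀ (b : Fin 4 → K) r, t r (0, b) (0, Pi.single k 1) = 0)) : 12 ≤ Fintype.card ι := by
  by_contra h
  exact false_of_allX (by omega) c t hJ hX

end Summit.ValiantsHypothesis.ValiantsHypothesis.Theorems.SymPencilPerFourInnerRankPureGramP1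

end
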